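import Summits.ValiantsHypothesis.ValiantsHypothesis.Theorems.KPlusLogSqLawTridiagonalRealStatic
import Summits.ValiantsHypothesis.ValiantsHypothesis.Theorems.KPlusLogSqLawStaticTridiagonalPivotLogConcave

/-!
# Static definite tridiagonal designs (ALL sizes): the PD-INTERVAL THEOREM and the BOTTOM-CLASS LAW
# «at most two positive determinant zeros on the positive-semidefinite boundary» (Part 2)

HONEST FRAMING.  Helper theorems (`--supports stmt-ValiantsHypothesis-19561 --as helper`; seat val-sym-lift-p2 g9, cell
`pub-symmetroid`, 2026-08-27) on the REAL side of the desk's typed α target (lead R2102/R2114): «a real symmetric TRIDIAGONAL matrix of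
MONOMIALS `c i j · X ^ (e i j)` with POSITIVE DIAGONAL COEFFICIENTS (a static definite tridiagonal design) has at most `C·m + C₀`
distinct positive determinant zeros».  That target is NOT proved here.  What is proved is an all-sizes STRUCTURE theorem for the
inertia-class decomposition `Z = Σ_j Z_j` of the positive zeros (`Z_j` = number of zeros at which the matrix has exactly `j` negative
eigenvalues): the BOTTOM class obeys `Z₀ ≤ 2` for EVERY size and EVERY such design (explicit constant, no genericity, no separation
hypothesis), because the positive-definite locus is an interval.  Located context (this seat, pure-python inertia walks, not claimed
in the kernel): the middle classes are NOT bounded by `2` (a `6 × 6` design with `Z₁ = 5`), so the linear law — if true — is a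
statement about the TOTAL, not about each class; for even `m` the TOP class also obeys `Z_{n−1} ≤ 2` on paper (the product of the
singular values of the bidiagonal factor is a monomial) — not filed.  Nothing here bears on `WeakLifting` (stmt-19561) / `TropicalB`
(stmt-19771) in their windows, on Conjecture B, the Door-A registers, `MatrixDescartes` (stmt-ValiantsHypothesis-18050) or VP ≠ VNP.

WHAT IS PROVED (Part 1 = `…StaticTridiagonalPivotLogConcave`: two-term Hölder, log-concavity of the pivots of abstract continuants).
1. `det_leadingBlock_eq_ctK`, `det_design_eq_ctK`, `eval_det_design`, `linkWeight_eq`, `diagSeq_pos`, `linkWeight_nonneg`,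
   `diagSeq_interp`, `linkWeight_interp` — bookkeeping: the leading principal minors of the real matrix `(c i j · t ^ (e i j))` of a
   tridiagonal design are the continuants (`ValuativeFlip.ctK`) of its three monomial sequences (tree: `StaticTridiagonalReal.det_of_tridiagonal`);
   the link weight of a symmetric design is `c_(s,s+1)² t^(…) ≥ 0`; at `y = x^p z^q` both sequences are the `(p,q)` geometric means of
   their values at `x` and `z`; the α target's polynomial determinant evaluates to the real determinant.
2. `ctK_design_pos_interp`, `ctK_design_nonneg_interp` — Part 1 specialised to the design.
3. **`leadingMinors_pos_of_mem_Icc` — PD-INTERVAL THEOREM (all `m`)**: if all leading principal minors of `(c i j · t^(e i j))` are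
   positive at `t = x` and at `t = z` (`0 < x`) then at every `t ∈ [x, z]`; i.e. (Sylvester's criterion) the positive-definite locus
   `{t > 0 : (c i j t^(e i j)) ≻ 0}` of a static definite tridiagonal design is an INTERVAL — every LDLᵀ pivot is log-concave in `log t`.
4. **`card_posRoots_bottomClass_le_two` — BOTTOM-CLASS LAW (all `m`)**: in the α target's own count (`roots.toFinset.filter`), the
   distinct positive roots of `det (C (c i j) · X ^ (e i j))` at which every PROPER leading principal minor of the real matrix is
   positive number AT MOST TWO.  By Jacobi's signature rule these are the zeros at which the singular matrix is positive semidefinite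
   with definite proper leading blocks — for an irreducible design (all `c_(s,s+1) ≠ 0`) ALL its positive-semidefinite zeros; i.e. the
   bottom eigenvalue branch meets `0` at most twice.  (Three such zeros `u₁ < u₂ < u₃`: non-roots `y₁ ∈ (u₁,u₂)`, `y₂ ∈ (u₂,u₃)` are
   positive-definite points by the semidefinite interpolation between `u₁` and `u₃`, and the PD-interval theorem between `y₁` and `y₂`
   forces `det > 0` at `u₂`.)
The same argument works verbatim for trees instead of paths and for real exponents; neither is filed.
[folklore: continuants / LDLᵀ (Jacobi's signature rule, Sylvester's criterion); the interval / bottom-class statements are this seat's.]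
-/

set_option linter.dupNamespace false
set_option autoImplicit false

namespace Summit.ValiantsHypothesis.ValiantsHypothesis.Theorems.KPlusLogSqLaw.DefiniteInterpolation

open Summit.ValiantsHypothesis.ValiantsHypothesis.Theorems.ValuativeFlip (ctK ctK_congr)

/-! ### The static definite tridiagonal design: continuant sequences, leading minors, interpolation identities

For a design `(c, e)` (`c i j · X ^ (e i j)`, `c` vanishing off the band `|i − j| ≤ 1`) and a real point `t`, the three continuant
sequences are: diagonal `s ↦ c_ss t^(e_ss)` (value `1` past the size, never read), negated superdiagonal `s ↦ −c_(s,s+1) t^(e_(s,s+1))`,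
subdiagonal `s ↦ c_(s,s−1) t^(e_(s,s−1))`; by the tree's `det_of_tridiagonal` the `k`-th leading principal minor of the real matrix
`(c i j · t ^ (e i j))` is the `k`-th continuant of these sequences. -/

section Design

open Summit.ValiantsHypothesis.ValiantsHypothesis.Theorems.KPlusLogSqLaw.StaticTridiagonalReal (det_of_tridiagonal)
open Polynomial

variable {m : ℕ} (c : Fin m → Fin m → ℝ) (e : Fin m → Fin m → ℕ)

/-- **Leading principal minors are continuants**: for `k ≤ m`, the determinant of the leading `k × k` block of the real matrix
`(c i j · t ^ (e i j))` (tridiagonal) is the `k`-th continuant of the design's three sequences at `t`. [folklore: continuant] -/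
theorem det_leadingBlock_eq_ctK (hband : ∀ i j : Fin m, (i : ℕ) + 1 < j ∨ (j : ℕ) + 1 < i → c i j = 0)
    (t : ℝ) {k : ℕ} (hk : k ≤ m) :
    (Matrix.of fun i j : Fin k => c (Fin.castLE hk i) (Fin.castLE hk j) * t ^ e (Fin.castLE hk i) (Fin.castLE hk j)).det =
      ctK (fun s : ℕ => if h : s < m then c ⟨s, h⟩ ⟨s, h⟩ * t ^ e ⟨s, h⟩ ⟨s, h⟩ else 1)
        (fun s : ℕ => -(if h : s + 1 < m then c ⟨s, by omega⟩ ⟨s + 1, h⟩ * t ^ e ⟨s, by omega⟩ ⟨s + 1, h⟩ else 0))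
        (fun s : ℕ => if h : 1 ≤ s ∧ s < m then c ⟨s, h.2⟩ ⟨s - 1, by omega⟩ * t ^ e ⟨s, h.2⟩ ⟨s - 1, by omega⟩ else 0) k := by
  rw [det_of_tridiagonal _ (by
    intro i j hij
    simp only [Matrix.of_apply]
    rw [hband _ _ (by simpa using hij), zero_mul])]
  refine ctK_congr k (fun s hs => ?_) (fun s hs => ?_) (fun s h1 hs => ?_)
  · rw [dif_pos hs, dif_pos (by omega)]; rfl
  · rw [dif_pos hs, dif_pos (by omega)]; rfl
  · rw [dif_pos ⟨h1, hs⟩, dif_pos ⟨h1, by omega⟩]; rfl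

/-- **The full determinant is the `m`-th continuant** of the design's sequences. [folklore: continuant] -/
theorem det_design_eq_ctK (hband : ∀ i j : Fin m, (i : ℕ) + 1 < j ∨ (j : ℕ) + 1 < i → c i j = 0) (t : ℝ) :
    (Matrix.of fun i j : Fin m => c i j * t ^ e i j).det =
      ctK (fun s : ℕ => if h : s < m then c ⟨s, h⟩ ⟨s, h⟩ * t ^ e ⟨s, h⟩ ⟨s, h⟩ else 1)
        (fun s : ℕ => -(if h : s + 1 < m then c ⟨s, by omega⟩ ⟨s + 1, h⟩ * t ^ e ⟨s, by omega⟩ ⟨s + 1, h⟩ else 0))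
        (fun s : ℕ => if h : 1 ≤ s ∧ s < m then c ⟨s, h.2⟩ ⟨s - 1, by omega⟩ * t ^ e ⟨s, h.2⟩ ⟨s - 1, by omega⟩ else 0) m := by
  rw [det_of_tridiagonal _ (by
    intro i j hij
    simp only [Matrix.of_apply]
    rw [hband _ _ hij, zero_mul])]
  refine ctK_congr m (fun s hs => ?_) (fun s hs => ?_) (fun s h1 hs => ?_)
  · rw [dif_pos hs, dif_pos hs]; rfl
  · rfl
  · rfl

/-- **Evaluation**: the polynomial determinant `det (C (c i j) · X ^ (e i j))` evaluated at `t` is the determinant of the real matrix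
`(c i j · t ^ (e i j))`. [folklore] -/
theorem eval_det_design (t : ℝ) :
    (Matrix.det (Matrix.of fun i j => C (c i j) * (X : ℝ[X]) ^ e i j)).eval t =
      (Matrix.of fun i j : Fin m => c i j * t ^ e i j).det := by
  rw [← Polynomial.coe_evalRingHom, RingHom.map_det, RingHom.mapMatrix_apply]
  congr 1
  ext i j
  simp [Matrix.map_apply, Matrix.of_apply]

/-- The diagonal sequence of a definite design is positive at a positive point. [this file] -/
theorem diagSeq_pos (hpos : ∀ i, 0 < c i i) {t : ℝ} (ht : 0 < t) (s : ℕ) :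
    0 < (fun s : ℕ => if h : s < m then c ⟨s, h⟩ ⟨s, h⟩ * t ^ e ⟨s, h⟩ ⟨s, h⟩ else 1) s := by
  simp only
  by_cases h : s < m
  · rw [dif_pos h]; exact mul_pos (hpos _) (pow_pos ht _)
  · rw [dif_neg h]; exact one_pos

/-- The link weight `−(M s · N (s+1)) = c_(s,s+1) c_(s+1,s) t^(e_(s,s+1) + e_(s+1,s))` of the design's sequences (a closed form valid for
every `t`; zero past the size). [this file] -/
theorem linkWeight_eq (t : ℝ) (s : ℕ) :
    -((fun s : ℕ => -(if h : s + 1 < m then c ⟨s, by omega⟩ ⟨s + 1, h⟩ * t ^ e ⟨s, by omega⟩ ⟨s + 1, h⟩ else 0)) s *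
        (fun s : ℕ => if h : 1 ≤ s ∧ s < m then c ⟨s, h.2⟩ ⟨s - 1, by omega⟩ * t ^ e ⟨s, h.2⟩ ⟨s - 1, by omega⟩ else 0) (s + 1)) =
      if h : s + 1 < m then
        (c ⟨s, by omega⟩ ⟨s + 1, h⟩ * c ⟨s + 1, h⟩ ⟨s, by omega⟩) * t ^ (e ⟨s, by omega⟩ ⟨s + 1, h⟩ + e ⟨s + 1, h⟩ ⟨s, by omega⟩)
      else 0 := by
  by_cases h : s + 1 < m
  · have h' : 1 ≤ s + 1 ∧ s + 1 < m := ⟨by omega, h⟩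
    simp only [dif_pos h, dif_pos h', Nat.add_sub_cancel]
    ring
  · have h' : ¬ (1 ≤ s + 1 ∧ s + 1 < m) := fun hh => h hh.2
    simp only [dif_neg h, dif_neg h', neg_zero, zero_mul]

/-- For a SYMMETRIC design the link weight is `c_(s,s+1)² · t^(…) ≥ 0` at `t > 0`. [this file] -/
theorem linkWeight_nonneg (hc : ∀ i j, c i j = c j i) {t : ℝ} (ht : 0 < t) (s : ℕ) :
    0 ≤ -((fun s : ℕ => -(if h : s + 1 < m then c ⟨s, by omega⟩ ⟨s + 1, h⟩ * t ^ e ⟨s, by omega⟩ ⟨s + 1, h⟩ else 0)) s *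
        (fun s : ℕ => if h : 1 ≤ s ∧ s < m then c ⟨s, h.2⟩ ⟨s - 1, by omega⟩ * t ^ e ⟨s, h.2⟩ ⟨s - 1, by omega⟩ else 0) (s + 1)) := by
  rw [linkWeight_eq]
  by_cases h : s + 1 < m
  · rw [dif_pos h, hc ⟨s + 1, h⟩]
    exact mul_nonneg (mul_self_nonneg _) (pow_nonneg ht.le _)
  · rw [dif_neg h]

/-- **Geometric interpolation of the diagonal sequence**: at `y = x^p z^q` the diagonal sequence is the `(p, q)` geometric mean of
its values at `x` and `z`. [this file] -/
theorem diagSeq_interp (hpos : ∀ i, 0 < c i i) {x z p q : ℝ} (hx : 0 < x) (hz : 0 < z)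
    (hp : 0 < p) (hpq : p + q = 1) (s : ℕ) :
    (fun s : ℕ => if h : s < m then c ⟨s, h⟩ ⟨s, h⟩ * (x ^ p * z ^ q) ^ e ⟨s, h⟩ ⟨s, h⟩ else 1) s =
      (fun s : ℕ => if h : s < m then c ⟨s, h⟩ ⟨s, h⟩ * x ^ e ⟨s, h⟩ ⟨s, h⟩ else 1) s ^ p *
        (fun s : ℕ => if h : s < m then c ⟨s, h⟩ ⟨s, h⟩ * z ^ e ⟨s, h⟩ ⟨s, h⟩ else 1) s ^ q := by
  simp only
  by_cases h : s < m
  · simp only [dif_pos h]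
    exact monomial_interp (hpos _).le hx hz hp hpq _
  · simp only [dif_neg h, Real.one_rpow, mul_one]

/-- **Geometric interpolation of the link weights** (symmetric design): at `y = x^p z^q` the link weight is the `(p, q)` geometric
mean of its values at `x` and `z`. [this file] -/
theorem linkWeight_interp (hc : ∀ i j, c i j = c j i) {x z p q : ℝ} (hx : 0 < x) (hz : 0 < z)
    (hp : 0 < p) (hpq : p + q = 1) (s : ℕ) :
    -((fun s : ℕ => -(if h : s + 1 < m then c ⟨s, by omega⟩ ⟨s + 1, h⟩ * (x ^ p * z ^ q) ^ e ⟨s, by omega⟩ ⟨s + 1, h⟩ else 0)) s *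
        (fun s : ℕ => if h : 1 ≤ s ∧ s < m then c ⟨s, h.2⟩ ⟨s - 1, by omega⟩ * (x ^ p * z ^ q) ^ e ⟨s, h.2⟩ ⟨s - 1, by omega⟩ else 0) (s + 1)) =
      (-((fun s : ℕ => -(if h : s + 1 < m then c ⟨s, by omega⟩ ⟨s + 1, h⟩ * x ^ e ⟨s, by omega⟩ ⟨s + 1, h⟩ else 0)) s *
          (fun s : ℕ => if h : 1 ≤ s ∧ s < m then c ⟨s, h.2⟩ ⟨s - 1, by omega⟩ * x ^ e ⟨s, h.2⟩ ⟨s - 1, by omega⟩ else 0) (s + 1))) ^ p *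
        (-((fun s : ℕ => -(if h : s + 1 < m then c ⟨s, by omega⟩ ⟨s + 1, h⟩ * z ^ e ⟨s, by omega⟩ ⟨s + 1, h⟩ else 0)) s *
          (fun s : ℕ => if h : 1 ≤ s ∧ s < m then c ⟨s, h.2⟩ ⟨s - 1, by omega⟩ * z ^ e ⟨s, h.2⟩ ⟨s - 1, by omega⟩ else 0) (s + 1))) ^ q := by
  rw [linkWeight_eq, linkWeight_eq, linkWeight_eq]
  by_cases h : s + 1 < m
  · simp only [dif_pos h]
    rw [hc ⟨s + 1, h⟩]
    exact monomial_interp (mul_self_nonneg _) hx hz hp hpq _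
  · simp only [dif_neg h, Real.zero_rpow hp.ne', zero_mul]

/-- **PD-interpolation for the design's continuants** (strict form): if `0 < x < y < z` and the first `n+1` continuants
(`k ≤ n`) are positive at `x` and at `z`, they are positive at `y`. [this file] -/
theorem ctK_design_pos_interp (hc : ∀ i j, c i j = c j i) (hpos : ∀ i, 0 < c i i)
    {x y z : ℝ} (hx : 0 < x) (hxy : x < y) (hyz : y < z) (n : ℕ)
    (hX : ∀ k ≤ n, 0 < ctK (fun s : ℕ => if h : s < m then c ⟨s, h⟩ ⟨s, h⟩ * x ^ e ⟨s, h⟩ ⟨s, h⟩ else 1)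
        (fun s : ℕ => -(if h : s + 1 < m then c ⟨s, by omega⟩ ⟨s + 1, h⟩ * x ^ e ⟨s, by omega⟩ ⟨s + 1, h⟩ else 0))
        (fun s : ℕ => if h : 1 ≤ s ∧ s < m then c ⟨s, h.2⟩ ⟨s - 1, by omega⟩ * x ^ e ⟨s, h.2⟩ ⟨s - 1, by omega⟩ else 0) k)
    (hZ : ∀ k ≤ n, 0 < ctK (fun s : ℕ => if h : s < m then c ⟨s, h⟩ ⟨s, h⟩ * z ^ e ⟨s, h⟩ ⟨s, h⟩ else 1)
        (fun s : ℕ => -(if h : s + 1 < m then c ⟨s, by omega⟩ ⟨s + 1, h⟩ * z ^ e ⟨s, by omega⟩ ⟨s + 1, h⟩ else 0))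
        (fun s : ℕ => if h : 1 ≤ s ∧ s < m then c ⟨s, h.2⟩ ⟨s - 1, by omega⟩ * z ^ e ⟨s, h.2⟩ ⟨s - 1, by omega⟩ else 0) k) :
    ∀ k ≤ n, 0 < ctK (fun s : ℕ => if h : s < m then c ⟨s, h⟩ ⟨s, h⟩ * y ^ e ⟨s, h⟩ ⟨s, h⟩ else 1)
        (fun s : ℕ => -(if h : s + 1 < m then c ⟨s, by omega⟩ ⟨s + 1, h⟩ * y ^ e ⟨s, by omega⟩ ⟨s + 1, h⟩ else 0))
        (fun s : ℕ => if h : 1 ≤ s ∧ s < m then c ⟨s, h.2⟩ ⟨s - 1, by omega⟩ * y ^ e ⟨s, h.2⟩ ⟨s - 1, by omega⟩ else 0) k := by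
  have hz : 0 < z := (hx.trans hxy).trans hyz
  obtain ⟨p, q, hp, hq, hpq, hy⟩ := exists_rpow_interp hx hxy hyz
  subst hy
  exact ctK_pos_interp hp hq hpq (diagSeq_pos c e hpos hx) (diagSeq_pos c e hpos hz)
    (diagSeq_interp c e hpos hx hz hp hpq) (linkWeight_nonneg c e hc hx) (linkWeight_nonneg c e hc hz)
    (linkWeight_interp c e hc hx hz hp hpq) n hX hZ

/-- **PD-interpolation for the design's continuants** (semidefinite endpoints): if `0 < x < y < z`, the continuants `k < n` are
positive and the `n`-th is non-negative at `x` and at `z`, then at `y` the continuants `k < n` are positive and the `n`-th is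
non-negative. [this file] -/
theorem ctK_design_nonneg_interp (hc : ∀ i j, c i j = c j i) (hpos : ∀ i, 0 < c i i)
    {x y z : ℝ} (hx : 0 < x) (hxy : x < y) (hyz : y < z) (n : ℕ)
    (hX : ∀ k < n, 0 < ctK (fun s : ℕ => if h : s < m then c ⟨s, h⟩ ⟨s, h⟩ * x ^ e ⟨s, h⟩ ⟨s, h⟩ else 1)
        (fun s : ℕ => -(if h : s + 1 < m then c ⟨s, by omega⟩ ⟨s + 1, h⟩ * x ^ e ⟨s, by omega⟩ ⟨s + 1, h⟩ else 0))
        (fun s : ℕ => if h : 1 ≤ s ∧ s < m then c ⟨s, h.2⟩ ⟨s - 1, by omega⟩ * x ^ e ⟨s, h.2⟩ ⟨s - 1, by omega⟩ else 0) k)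
    (hZ : ∀ k < n, 0 < ctK (fun s : ℕ => if h : s < m then c ⟨s, h⟩ ⟨s, h⟩ * z ^ e ⟨s, h⟩ ⟨s, h⟩ else 1)
        (fun s : ℕ => -(if h : s + 1 < m then c ⟨s, by omega⟩ ⟨s + 1, h⟩ * z ^ e ⟨s, by omega⟩ ⟨s + 1, h⟩ else 0))
        (fun s : ℕ => if h : 1 ≤ s ∧ s < m then c ⟨s, h.2⟩ ⟨s - 1, by omega⟩ * z ^ e ⟨s, h.2⟩ ⟨s - 1, by omega⟩ else 0) k)
    (hXn : 0 ≤ ctK (fun s : ℕ => if h : s < m then c ⟨s, h⟩ ⟨s, h⟩ * x ^ e ⟨s, h⟩ ⟨s, h⟩ else 1)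
        (fun s : ℕ => -(if h : s + 1 < m then c ⟨s, by omega⟩ ⟨s + 1, h⟩ * x ^ e ⟨s, by omega⟩ ⟨s + 1, h⟩ else 0))
        (fun s : ℕ => if h : 1 ≤ s ∧ s < m then c ⟨s, h.2⟩ ⟨s - 1, by omega⟩ * x ^ e ⟨s, h.2⟩ ⟨s - 1, by omega⟩ else 0) n)
    (hZn : 0 ≤ ctK (fun s : ℕ => if h : s < m then c ⟨s, h⟩ ⟨s, h⟩ * z ^ e ⟨s, h⟩ ⟨s, h⟩ else 1)
        (fun s : ℕ => -(if h : s + 1 < m then c ⟨s, by omega⟩ ⟨s + 1, h⟩ * z ^ e ⟨s, by omega⟩ ⟨s + 1, h⟩ else 0))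
        (fun s : ℕ => if h : 1 ≤ s ∧ s < m then c ⟨s, h.2⟩ ⟨s - 1, by omega⟩ * z ^ e ⟨s, h.2⟩ ⟨s - 1, by omega⟩ else 0) n) :
    (∀ k < n, 0 < ctK (fun s : ℕ => if h : s < m then c ⟨s, h⟩ ⟨s, h⟩ * y ^ e ⟨s, h⟩ ⟨s, h⟩ else 1)
        (fun s : ℕ => -(if h : s + 1 < m then c ⟨s, by omega⟩ ⟨s + 1, h⟩ * y ^ e ⟨s, by omega⟩ ⟨s + 1, h⟩ else 0))
        (fun s : ℕ => if h : 1 ≤ s ∧ s < m then c ⟨s, h.2⟩ ⟨s - 1, by omega⟩ * y ^ e ⟨s, h.2⟩ ⟨s - 1, by omega⟩ else 0) k) ∧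
      0 ≤ ctK (fun s : ℕ => if h : s < m then c ⟨s, h⟩ ⟨s, h⟩ * y ^ e ⟨s, h⟩ ⟨s, h⟩ else 1)
        (fun s : ℕ => -(if h : s + 1 < m then c ⟨s, by omega⟩ ⟨s + 1, h⟩ * y ^ e ⟨s, by omega⟩ ⟨s + 1, h⟩ else 0))
        (fun s : ℕ => if h : 1 ≤ s ∧ s < m then c ⟨s, h.2⟩ ⟨s - 1, by omega⟩ * y ^ e ⟨s, h.2⟩ ⟨s - 1, by omega⟩ else 0) n := by
  have hz : 0 < z := (hx.trans hxy).trans hyz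
  obtain ⟨p, q, hp, hq, hpq, hy⟩ := exists_rpow_interp hx hxy hyz
  subst hy
  exact ctK_nonneg_interp hp hq hpq (diagSeq_pos c e hpos hx) (diagSeq_pos c e hpos hz)
    (diagSeq_interp c e hpos hx hz hp hpq) (linkWeight_nonneg c e hc hx) (linkWeight_nonneg c e hc hz)
    (linkWeight_interp c e hc hx hz hp hpq) n hX hZ hXn hZn

end Design


/-! ### The two theorems in the currency of the typed α target (lead R2102/R2114)

A STATIC DEFINITE TRIDIAGONAL DESIGN is `(c, e)` with `c i j = c j i`, `c` vanishing off the band `|i − j| ≤ 1` and `0 < c i i`;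
its real matrix at `t` is `(c i j · t ^ (e i j))` and its `k`-th LEADING PRINCIPAL MINOR at `t` is the determinant of the leading
`k × k` block.  By Sylvester's criterion «all leading principal minors positive» is «positive definite», and (Jacobi's signature
rule) a determinant zero at which the proper leading principal minors are all positive is a zero at which the matrix is positive
SEMIdefinite of corank one — the BOTTOM inertia class (no negative eigenvalue). -/

section Target

open Polynomial

variable {m : ℕ} (c : Fin m → Fin m → ℝ) (e : Fin m → Fin m → ℕ)

/-- **PD-INTERVAL THEOREM (all sizes).**  For a static definite tridiagonal design, if ALL leading principal minors
(`k = 0, …, m`, the last being the determinant) of the real matrix `(c i j · t ^ (e i j))` are positive at `t = x` and at `t = z`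
(`0 < x`), then they are all positive at every `y ∈ [x, z]`: the positive-definite locus `{t > 0 : (c i j t^(e i j)) ≻ 0}` is an
INTERVAL.  Mechanism: along `y = x^(1−θ) z^θ` every LDLᵀ pivot is log-concave (two-term Hölder step). [this file] -/
theorem leadingMinors_pos_of_mem_Icc (hc : ∀ i j, c i j = c j i)
    (hband : ∀ i j : Fin m, (i : ℕ) + 1 < j ∨ (j : ℕ) + 1 < i → c i j = 0) (hpos : ∀ i, 0 < c i i)
    {x y z : ℝ} (hx : 0 < x) (hxy : x ≤ y) (hyz : y ≤ z)
    (hX : ∀ (k : ℕ) (hk : k ≤ m), 0 < (Matrix.of fun i j : Fin k => c (Fin.castLE hk i) (Fin.castLE hk j) * x ^ e (Fin.castLE hk i) (Fin.castLE hk j)).det)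
    (hZ : ∀ (k : ℕ) (hk : k ≤ m), 0 < (Matrix.of fun i j : Fin k => c (Fin.castLE hk i) (Fin.castLE hk j) * z ^ e (Fin.castLE hk i) (Fin.castLE hk j)).det) :
    ∀ (k : ℕ) (hk : k ≤ m), 0 < (Matrix.of fun i j : Fin k => c (Fin.castLE hk i) (Fin.castLE hk j) * y ^ e (Fin.castLE hk i) (Fin.castLE hk j)).det := by
  rcases hxy.eq_or_lt with hxy' | hxy'
  · subst hxy'; exact hX
  rcases hyz.eq_or_lt with hyz' | hyz'
  · subst hyz'; exact hZ
  intro k hk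
  rw [det_leadingBlock_eq_ctK c e hband y hk]
  refine ctK_design_pos_interp c e hc hpos hx hxy' hyz' m (fun k hk => ?_) (fun k hk => ?_) k hk
  · rw [← det_leadingBlock_eq_ctK c e hband x hk]; exact hX k hk
  · rw [← det_leadingBlock_eq_ctK c e hband z hk]; exact hZ k hk

/-- **BOTTOM-CLASS LAW (all sizes): at most TWO positive determinant zeros on the positive-semidefinite boundary.**  For a static
definite tridiagonal design, the number of distinct positive roots `t` of the polynomial determinant `det (C (c i j) · X ^ (e i j))` at
which every PROPER leading principal minor of the real matrix `(c i j · t ^ (e i j))` is positive (equivalently, by Jacobi's signature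
rule: at which the singular matrix has NO negative eigenvalue — the bottom inertia class `Z₀`) is at most `2`, in the count
`roots.toFinset.filter` of the typed α target.  Proof: three such zeros `u₁ < u₂ < u₃` and two non-roots `y₁ ∈ (u₁, u₂)`, `y₂ ∈ (u₂, u₃)`;
the semidefinite interpolation between `u₁` and `u₃` makes `y₁`, `y₂` positive-definite points, and the PD-interval theorem between
`y₁` and `y₂` forces `det > 0` at `u₂`. [this file] -/
theorem card_posRoots_bottomClass_le_two (hc : ∀ i j, c i j = c j i)
    (hband : ∀ i j : Fin m, (i : ℕ) + 1 < j ∨ (j : ℕ) + 1 < i → c i j = 0) (hpos : ∀ i, 0 < c i i) :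
    ((Matrix.det (Matrix.of fun i j => C (c i j) * (X : ℝ[X]) ^ e i j)).roots.toFinset.filter
      (fun t : ℝ => 0 < t ∧ ∀ (k : ℕ) (hk : k < m),
        0 < (Matrix.of fun i j : Fin k => c (Fin.castLE hk.le i) (Fin.castLE hk.le j) * t ^ e (Fin.castLE hk.le i) (Fin.castLE hk.le j)).det)).card ≤ 2 := by
  set P : ℝ[X] := Matrix.det (Matrix.of fun i j => C (c i j) * (X : ℝ[X]) ^ e i j) with hP
  set S := P.roots.toFinset.filter (fun t : ℝ => 0 < t ∧ ∀ (k : ℕ) (hk : k < m),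
        0 < (Matrix.of fun i j : Fin k => c (Fin.castLE hk.le i) (Fin.castLE hk.le j) * t ^ e (Fin.castLE hk.le i) (Fin.castLE hk.le j)).det) with hS
  by_contra hcard
  rw [not_le] at hcard
  -- unpack membership
  have hmem : ∀ t ∈ S, P ≠ 0 ∧ P.eval t = 0 ∧ 0 < t ∧
      (∀ k < m, 0 < ctK (fun s : ℕ => if h : s < m then c ⟨s, h⟩ ⟨s, h⟩ * t ^ e ⟨s, h⟩ ⟨s, h⟩ else 1)
        (fun s : ℕ => -(if h : s + 1 < m then c ⟨s, by omega⟩ ⟨s + 1, h⟩ * t ^ e ⟨s, by omega⟩ ⟨s + 1, h⟩ else 0))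
        (fun s : ℕ => if h : 1 ≤ s ∧ s < m then c ⟨s, h.2⟩ ⟨s - 1, by omega⟩ * t ^ e ⟨s, h.2⟩ ⟨s - 1, by omega⟩ else 0) k) ∧
      ctK (fun s : ℕ => if h : s < m then c ⟨s, h⟩ ⟨s, h⟩ * t ^ e ⟨s, h⟩ ⟨s, h⟩ else 1)
        (fun s : ℕ => -(if h : s + 1 < m then c ⟨s, by omega⟩ ⟨s + 1, h⟩ * t ^ e ⟨s, by omega⟩ ⟨s + 1, h⟩ else 0))
        (fun s : ℕ => if h : 1 ≤ s ∧ s < m then c ⟨s, h.2⟩ ⟨s - 1, by omega⟩ * t ^ e ⟨s, h.2⟩ ⟨s - 1, by omega⟩ else 0) m = 0 := by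
    intro t ht
    rw [hS, Finset.mem_filter, Multiset.mem_toFinset, Polynomial.mem_roots'] at ht
    obtain ⟨⟨hP0, hroot⟩, ht0, hmin⟩ := ht
    refine ⟨hP0, hroot, ht0, fun k hk => ?_, ?_⟩
    · rw [← det_leadingBlock_eq_ctK c e hband t hk.le]; exact hmin k hk
    · rw [← det_design_eq_ctK c e hband t, ← eval_det_design c e t]; exact hroot
  -- a non-root strictly between two members is a positive-definite point
  have hgap : ∀ u ∈ S, ∀ v ∈ S, ∀ w : ℝ, u < w → w < v → w ∉ P.roots.toFinset →
      ∀ k ≤ m, 0 < ctK (fun s : ℕ => if h : s < m then c ⟨s, h⟩ ⟨s, h⟩ * w ^ e ⟨s, h⟩ ⟨s, h⟩ else 1)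
        (fun s : ℕ => -(if h : s + 1 < m then c ⟨s, by omega⟩ ⟨s + 1, h⟩ * w ^ e ⟨s, by omega⟩ ⟨s + 1, h⟩ else 0))
        (fun s : ℕ => if h : 1 ≤ s ∧ s < m then c ⟨s, h.2⟩ ⟨s - 1, by omega⟩ * w ^ e ⟨s, h.2⟩ ⟨s - 1, by omega⟩ else 0) k := by
    intro u hu v hv w huw hwv hw
    obtain ⟨hP0, -, hu0, huK, hum⟩ := hmem u hu
    obtain ⟨-, -, -, hvK, hvm⟩ := hmem v hv
    have hw0 : 0 < w := hu0.trans huw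
    obtain ⟨hlt, hle⟩ := ctK_design_nonneg_interp c e hc hpos hu0 huw hwv m huK hvK hum.ge hvm.ge
    have hne : ctK (fun s : ℕ => if h : s < m then c ⟨s, h⟩ ⟨s, h⟩ * w ^ e ⟨s, h⟩ ⟨s, h⟩ else 1)
        (fun s : ℕ => -(if h : s + 1 < m then c ⟨s, by omega⟩ ⟨s + 1, h⟩ * w ^ e ⟨s, by omega⟩ ⟨s + 1, h⟩ else 0))
        (fun s : ℕ => if h : 1 ≤ s ∧ s < m then c ⟨s, h.2⟩ ⟨s - 1, by omega⟩ * w ^ e ⟨s, h.2⟩ ⟨s - 1, by omega⟩ else 0) m ≠ 0 := by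
      intro h0
      apply hw
      rw [Multiset.mem_toFinset, Polynomial.mem_roots hP0, Polynomial.IsRoot.def, eval_det_design c e w,
        det_design_eq_ctK c e hband w]
      exact h0
    intro k hk
    rcases Nat.lt_or_ge k m with h | h
    · exact hlt k h
    · have : k = m := by omega
      rw [this]; exact lt_of_le_of_ne hle (Ne.symm hne)
  -- three members x < y < z
  have hne : S.Nonempty := Finset.card_pos.mp (by omega)
  set x := S.min' hne with hx
  set z := S.max' hne with hz
  have hxS : x ∈ S := Finset.min'_mem S hne
  have hzS : z ∈ S := Finset.max'_mem S hne
  have hcard' : 0 < ((S.erase x).erase z).card := by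
    have h1 : (S.erase x).card = S.card - 1 := Finset.card_erase_of_mem hxS
    have h2 : (S.erase x).card - 1 ≤ ((S.erase x).erase z).card := Finset.pred_card_le_card_erase
    omega
  obtain ⟨y, hy⟩ := Finset.card_pos.mp hcard'
  rw [Finset.mem_erase, Finset.mem_erase] at hy
  obtain ⟨hyz, hyx, hyS⟩ := hy
  have hxy : x < y := lt_of_le_of_ne (Finset.min'_le S y hyS) (Ne.symm hyx)
  have hyz' : y < z := lt_of_le_of_ne (Finset.le_max' S y hyS) hyz
  -- non-roots y₁ ∈ (x, y), y₂ ∈ (y, z)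
  obtain ⟨y₁, hy₁, hy₁r⟩ := Set.Infinite.exists_notMem_finset (Set.Ioo_infinite hxy) P.roots.toFinset
  obtain ⟨y₂, hy₂, hy₂r⟩ := Set.Infinite.exists_notMem_finset (Set.Ioo_infinite hyz') P.roots.toFinset
  have h₁ := hgap x hxS y hyS y₁ hy₁.1 hy₁.2 hy₁r
  have h₂ := hgap y hyS z hzS y₂ hy₂.1 hy₂.2 hy₂r
  obtain ⟨-, -, hx0, -, -⟩ := hmem x hxS
  obtain ⟨-, -, -, -, hym⟩ := hmem y hyS
  have hy₁0 : 0 < y₁ := hx0.trans hy₁.1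
  have hpos' := ctK_design_pos_interp c e hc hpos hy₁0 hy₁.2 hy₂.1 m h₁ h₂ m le_rfl
  rw [hym] at hpos'
  exact lt_irrefl 0 hpos'

end Target
end Summit.ValiantsHypothesis.ValiantsHypothesis.Theorems.KPlusLogSqLaw.DefiniteInterpolation
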